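import Mathlib.CategoryTheory.Limits.Types.Coproducts
import Literature.AnabelianGeometry.SemiGraphs.QuasiTemperoidsQDPairs
import HarnessLib

/-!
# Semi-graphs of anabelioids, Appendix: Definition A.3 (i) — weakly connected QD-pairs
# (kernel closure census of the predicate `QDPair.IsWeaklyConnected`)

Mochizuki, *Semi-graphs of anabelioids*, Publ. RIMS **42** (2006) 221–322, Appendix
"Quasi-temperoids", Definition A.3 (i), manuscript p. 82 [cite: MochizukiSemiAnbd2006, Def A.3(i) p.82]:
"Any pair `(A, Γ_A)` … will be referred to as a QD-pair. If `Γ_A` acts transitively on `π₀(A)`, then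
we shall say that this QD-pair is *weakly connected*; if `A` is connected, then we shall say that this
QD-pair is *strongly connected*."

PROOF-ONLY companion of `QuasiTemperoidsQDPairs.lean` (no definitions). The declaration
`QDPair.IsWeaklyConnected` is a PREDICATE on QD-pairs (a definition, [SemiAnbd] Def. A.3 (i)), not a
published theorem; it sits in the abc-iut cell's frozen fact list as row F-1630 (labelled
"witness-candidate" by a conclusion-head match). This file records in the kernel what there is to
know about it:

* `IsComponent.isIso_of_isConnectedObj` — a connected component `C → A` of a CONNECTED object is an
  isomorphism (its complementary summand is initial; any category);
* `QDPair.IsStronglyConnected.isWeaklyConnected` — the terminology is coherent: a strongly connected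
  QD-pair is weakly connected (any category; `γ = 1`);
* `QDPair.not_isWeaklyConnected_of_isInitial` — a QD-pair on an empty [initial] object is not weakly
  connected; hence the UNIVERSAL CLOSURE of the predicate is FALSE
  (`QDPair.not_forall_isWeaklyConnected`, witness `(∅, {1})` in the category of types), so the row is a
  schema to be used at instances, not an assumption to bind unapplied.

Nothing here bears on, or takes a side on, [IUTchIII] Cor. 3.12; typed ≠ proved.
-/

open CategoryTheory CategoryTheory.Limits

namespace Literature.AnabelianGeometry.SemiGraphs

open Literature.AlgebraicGeometry.Frobenioids (IsConnectedObj IsNonemptyObj)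

universe v₁ u₁ u

section AnyCategory

variable {Q : Type u₁} [Category.{v₁} Q]

/-- A connected component `ι : C → A` (`A ≅ C ⊔ D`, `C` connected) of a **connected** object `A` is an
isomorphism: `D` cannot be nonempty (else `A` would be a coproduct of two nonempty objects), so `D` is
initial and the coprojection `C → C ⊔ D` is invertible. [cite: MochizukiSemiAnbd2006, Def A.3(i) p.82] -/
theorem IsComponent.isIso_of_isConnectedObj {C A : Q} {ι : C ⟶ A} (hι : IsComponent ι)
    (hA : IsConnectedObj A) : IsIso ι := by
  obtain ⟨hC, D, κ, ⟨hc⟩⟩ := hι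
  have hD : ¬ IsNonemptyObj D := fun hD => (hA.2 C D ι κ hC.1 hD).false hc
  obtain ⟨hDI⟩ := not_isEmpty_iff.mp hD
  exact (BinaryCofan.isColimit_iff_isIso_inl hDI (BinaryCofan.mk ι κ)).mp ⟨hc⟩

/-- **Definition A.3 (i), coherence of the terminology**: a strongly connected QD-pair `(A, Γ_A)`
(`A` connected) is weakly connected — `A` is nonempty, and any two connected components of `A` are
isomorphisms `C₁ ≅ A ≅ C₂`, related by `γ = 1 ∈ Γ_A`. [cite: MochizukiSemiAnbd2006, Def A.3(i) p.82] -/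
theorem QDPair.IsStronglyConnected.isWeaklyConnected {P : QDPair Q} (h : P.IsStronglyConnected) :
    P.IsWeaklyConnected := by
  refine ⟨h.1, fun C₁ C₂ ι₁ ι₂ h₁ h₂ => ?_⟩
  haveI := h₁.isIso_of_isConnectedObj h
  haveI := h₂.isIso_of_isConnectedObj h
  refine ⟨1, P.Γ.one_mem, asIso ι₁ ≪≫ (asIso ι₂).symm, ?_⟩
  change ι₁ ≫ 𝟙 P.A = (ι₁ ≫ inv ι₂) ≫ ι₂
  rw [Category.comp_id, Category.assoc, IsIso.inv_hom_id, Category.comp_id]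

/-- A QD-pair whose object `A` is empty [initial] is NOT weakly connected (weak connectedness
requires `A` nonempty: "the quotient … is connected iff the QD-pair is weakly connected", Def. A.3
(iii)). [cite: MochizukiSemiAnbd2006, Def A.3(i) p.82] -/
theorem QDPair.not_isWeaklyConnected_of_isInitial {P : QDPair Q} (hP : IsInitial P.A) :
    ¬ P.IsWeaklyConnected :=
  fun h => h.1.false hP

end AnyCategory

/-- F-1630 is a PREDICATE, not a theorem: its universal closure is FALSE — the QD-pair `(∅, {1})` of
the category of types (`∅ = PEmpty` is initial there) is not weakly connected.
[cite: MochizukiSemiAnbd2006, Def A.3(i) p.82] -/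
theorem QDPair.not_forall_isWeaklyConnected :
    ¬ ∀ (Q : Type (u + 1)) [Category.{u} Q] (P : QDPair Q), P.IsWeaklyConnected :=
  fun h => QDPair.not_isWeaklyConnected_of_isInitial (Q := Type u) (P := ⟨PEmpty, ⊥⟩)
    Types.isInitialPEmpty (h (Type u) _)

end Literature.AnabelianGeometry.SemiGraphs
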